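import Summits.ResolutionOfSingularities.ResolutionOfSingularities.Theorems.EquisingularLiftEquisingularLiftNatNoseResidueSingularLocusCensus
import Summits.ResolutionOfSingularities.ResolutionOfSingularities.Theorems.HilbertSamuelEliminationSigmaMaxModificationsCorridor3WLadderIsoTailsBaseChangeFibre
import HarnessLib

/-!
# [OURS · L1 W4.5(b) · EL♮(3)] NOSE RESIDUE STRUCTURE, brick 7 — the singular locus of a residue surface `H ⊂ ℙ³_k` is
# «finitely many one-dimensional SINGULAR CURVES + finitely many CLOSED POINTS»

Cell `res-hironaka`, rung L, slot W4.5(b), D-0157 DOOR 1 width seat `res-L1-w45b-nose-w4` (desk WIDTH TABLE D1 row nose-w4, desk word (ii));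
crux CHILD EL♮(3) = stmt-ResolutionOfSingularities-20148 (parent EL♮ stmt-…-20038). OURS; NOT a statement of any manuscript; nothing of
[Hironaka2017] is asserted or used; AI kernel work, weaker than expert review. Resolution of singularities in positive characteristic is NOT proved here
(dimension 3 is a theorem in print, Cossart–Piltant 2008/2009). No `sorry`, no new definition, no instance, no notation; standard axioms.
`--kind proof --supports stmt-ResolutionOfSingularities-20148 --as helper`.  Sister files: bricks 1–6 (`…NatNoseResidueUnfold`/`Core`/`TopLocus`/`ClassTwoRegular`/
`Profile`/`SingularLocusCensus`/`CurveAtoms`).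

* (tree, reused) `…SigmaMaxModificationsCorridor3.IsoTailsHS.isClosed_singleton_of_mem_finite_closed` — in a JACOBSON space every point of a finite closed set
  is a closed point.
* ★ `singularLocus_curves_and_points_three` — for `ι : H ↪ ℙ³_k` a closed immersion of an integral NON-regular scheme (`k` any field):
  `ι(Sing H) = ⋃₀ 𝒞 ∪ P` with `𝒞` a FINITE family of SINGULAR CURVES (closed, irreducible, infinite, `⊆ ι(Sing H)`, `ι(H) ⊄ C`, `topologicalKrullDim C = 1`, and the
  curve clause `dim 𝒪_{C̃,z} = 1` at closed points of the reduced subscheme) and `P` a FINITE set of CLOSED points of `ℙ³_k` lying in `ι(Sing H)`.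
  Ingredients: brick 5 `singularLocus_finite_decomposition`, brick 2 `topologicalKrullDim_eq_one_of_three` / `ringKrullDim_stalk_redSub_eq_one`, Mathlib
  `LocallyOfFiniteType.jacobsonSpace` (`ℙ³_k` is Jacobson).  Reading for the planner: the non-isolated residue's `H` has finitely many singular curves
  `C₁, …, C_m` (m ≥ 1 since `Sing H` is infinite) and finitely many further singular points; bricks 2–4/6 apply to EACH `Cᵢ` (class₂ ⇒ smooth + persistence;
  singular `C̃ᵢ` ⇒ no nose class, finitely many bad points of its own).
-/

set_option linter.dupNamespace false

noncomputable section

open CategoryTheory CategoryTheory.Limits AlgebraicGeometry TopologicalSpace Topology IsLocalRing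
open Literature.AlgebraicGeometry.Resolution
open Literature.AlgebraicGeometry.Motives
open AlgebraicGeometry.Scheme.IdealSheafData
open Summit.ResolutionOfSingularities.ResolutionOfSingularities.Cruxes.EquisingularLift.StrataSplit

namespace Summit.ResolutionOfSingularities.ResolutionOfSingularities.Cruxes.EquisingularLiftNat.Sections

/-- **THE SINGULAR LOCUS OF A RESIDUE SURFACE: finitely many singular curves plus finitely many closed points.** For a closed immersion
`ι : H ↪ ℙ³_k` (`k` a field) of an integral non-regular scheme, `ι(Sing H) = ⋃₀ 𝒞 ∪ P` where `𝒞` is a finite family of closed irreducible infinite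
`C ⊆ ι(Sing H)` with `ι(H) ⊄ C`, `topologicalKrullDim C = 1` and one-dimensional local rings of the reduced subscheme at closed points (the SINGULAR CURVES
of `H`), and `P ⊆ ι(Sing H)` is a finite set of closed points of `ℙ³_k`. [folklore] -/
theorem singularLocus_curves_and_points_three (k : Type) [Field k] (H : Scheme.{0}) (ι : H ⟶ (projectiveSpace 3 k).left)
    [IsClosedImmersion ι] [IsIntegral H] (hH : ¬ Literature.AlgebraicGeometry.Resolution.Scheme.IsRegular H) :
    ∃ (𝒞 : Set (Set (projectiveSpace 3 k).left)) (P : Set (projectiveSpace 3 k).left), 𝒞.Finite ∧ P.Finite ∧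
      (∀ C ∈ 𝒞, ∃ hC : IsClosed C, IsIrreducible C ∧ C.Infinite ∧ C ⊆ ι '' {x : H | ¬ IsRegularLocalRing (H.presheaf.stalk x)} ∧
        C ⊆ Set.range ι ∧ ¬ (Set.range ι ⊆ C) ∧ topologicalKrullDim C = 1 ∧
        ∀ z : ↥(redSub (projectiveSpace 3 k).left C hC), IsClosed ({z} : Set ↥(redSub (projectiveSpace 3 k).left C hC)) →
          ringKrullDim ((redSub (projectiveSpace 3 k).left C hC).presheaf.stalk z) = ((1 : ℕ) : WithBot ℕ∞)) ∧
      (∀ p ∈ P, IsClosed ({p} : Set (projectiveSpace 3 k).left) ∧ p ∈ ι '' {x : H | ¬ IsRegularLocalRing (H.presheaf.stalk x)}) ∧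
      ι '' {x : H | ¬ IsRegularLocalRing (H.presheaf.stalk x)} = ⋃₀ 𝒞 ∪ P := by
  haveI : IsProper (projectiveSpace 3 k).hom := isProper_projectiveSpace 3 k
  haveI : JacobsonSpace ↥(projectiveSpace 3 k).left := LocallyOfFiniteType.jacobsonSpace (projectiveSpace 3 k).hom
  obtain ⟨𝒞₀, hfin, hprop, hU⟩ := singularLocus_finite_decomposition k 3 H ι
  refine ⟨{C ∈ 𝒞₀ | C.Infinite}, ⋃₀ {C ∈ 𝒞₀ | C.Finite}, hfin.subset (Set.sep_subset _ _),
    (hfin.subset (Set.sep_subset _ _)).sUnion fun C hC => hC.2, ?_, ?_, ?_⟩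
  · rintro C ⟨hC₀, hCinf⟩
    obtain ⟨hCc, hCirr, hCS, hCr, hCn⟩ := hprop C hC₀
    exact ⟨hCc, hCirr, hCinf, hCS, hCr, hCn, topologicalKrullDim_eq_one_of_three k H ι hH hCc hCinf hCr hCn,
      ringKrullDim_stalk_redSub_eq_one k H ι hH hCc hCirr hCinf hCr hCn⟩
  · rintro p ⟨C, ⟨hC₀, hCfin⟩, hpC⟩
    obtain ⟨hCc, -, hCS, -, -⟩ := hprop C hC₀
    exact ⟨Summit.ResolutionOfSingularities.ResolutionOfSingularities.Theorems.SigmaMaxModificationsCorridor3.IsoTailsHS.isClosed_singleton_of_mem_finite_closed hCc hCfin hpC, hCS hpC⟩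
  · rw [← hU]
    ext x
    simp only [Set.mem_sUnion, Set.mem_union, Set.mem_setOf_eq]
    constructor
    · rintro ⟨C, hC, hx⟩
      by_cases h : C.Infinite
      · exact Or.inl ⟨C, ⟨hC, h⟩, hx⟩
      · exact Or.inr ⟨C, ⟨hC, Set.not_infinite.mp h⟩, hx⟩
    · rintro (⟨C, ⟨hC, -⟩, hx⟩ | ⟨C, ⟨hC, -⟩, hx⟩)
      · exact ⟨C, hC, hx⟩
      · exact ⟨C, hC, hx⟩

/-- For the residue's `H` (infinitely many non-regular points) the family of singular curves is NON-EMPTY. [folklore] -/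
theorem singularCurves_nonempty_three (k : Type) [Field k] (H : Scheme.{0}) (ι : H ⟶ (projectiveSpace 3 k).left)
    [IsClosedImmersion ι] [IsIntegral H] (hinf : ¬ Set.Finite {x : H | ¬ IsRegularLocalRing (H.presheaf.stalk x)})
    (𝒞 : Set (Set (projectiveSpace 3 k).left)) (P : Set (projectiveSpace 3 k).left) (hP : P.Finite)
    (hU : ι '' {x : H | ¬ IsRegularLocalRing (H.presheaf.stalk x)} = ⋃₀ 𝒞 ∪ P) : 𝒞.Nonempty := by
  by_contra h
  rw [Set.not_nonempty_iff_eq_empty] at h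
  rw [h, Set.sUnion_empty, Set.empty_union] at hU
  apply hinf
  have hfinim : (ι '' {x : H | ¬ IsRegularLocalRing (H.presheaf.stalk x)}).Finite := by rw [hU]; exact hP
  exact Set.Finite.of_finite_image hfinim ι.isClosedEmbedding.injective.injOn

end Summit.ResolutionOfSingularities.ResolutionOfSingularities.Cruxes.EquisingularLiftNat.Sections

end
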